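import Literature.Geometry.Riemannian.CutTimeSemicontinuity
import Literature.Geometry.Riemannian.CutLocusMultiplicity
import HarnessLib

/-!
# `cutLocus_isClosed_and_mem_of_two_le` from `lee_expMap_injectivityDomain` (Lee 2018, Thm. 10.34)

Assembly file of the programme towards the named fact `cutLocus_isClosed_and_mem_of_two_le`
(`CutLocusBishop.lean`; Lee 2018, Thm. 10.34 (a) and Prop. 10.32 (a), for the metric cut locus of
`CutLocus.lean`). Clause (2) is the theorem `mem_cutLocus_of_two_le_minimalGeodesicMultiplicity`
(`CutLocusMultiplicity.lean`). Clause (1), "`cutLocus g hg p` is closed", is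
`isClosed_cutLocus_of_injective_mfderiv` (`CutTimeSemicontinuity.lean`) granted that `exp_p` has
no critical points in the injectivity domain `ID(p)` — the last clause of Lee's Thm. 10.34 (c),
vendored in the tree as part of the named fact `lee_expMap_injectivityDomain`
(`ExponentialMap.lean`; its proof is Prop. 10.20 with Thm. 10.26, Jacobi fields and the second
variation formula). This file records the resulting implication between the two named facts:

* `cutLocus_isClosed_and_mem_of_two_le_of_injectivityDomain` —
  `lee_expMap_injectivityDomain → cutLocus_isClosed_and_mem_of_two_le`.

No definitions and no named facts are introduced (D-0026); the hypothesis is an existing named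
fact of the tree, not a restatement of the conclusion (it concerns the differential of `exp_p`,
the conclusion concerns the metric cut locus).

## References

* J. M. Lee, *Introduction to Riemannian Manifolds*, 2nd ed. (2018), Prop. 10.32, Thm. 10.33,
  Thm. 10.34. [LeeRiemannianManifolds2018]
-/

noncomputable section

open Bundle Set Filter Function Manifold
open scoped Manifold ContDiff Topology ENNReal NNReal

universe u v w

namespace Literature.Geometry.Riemannian

open Literature.Geometry.Lorentzian
open Literature.Geometry.Lorentzian.PseudoRiemannianMetric

/-- **Lee 2018, Thm. 10.34 (a) and Prop. 10.32 (a) for the metric cut locus, from Thm. 10.34 (c)**: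
the named fact `cutLocus_isClosed_and_mem_of_two_le` (the cut locus of a point of a connected
Riemannian manifold with compact closed balls is closed, and contains every point reached by two
distinct minimal geodesics) follows from the named fact `lee_expMap_injectivityDomain` (of which
only the last clause, "`d(exp_p)_v` is bijective for `v ∈ ID(p)`", is used). Clause (2) is
unconditional (`mem_cutLocus_of_two_le_minimalGeodesicMultiplicity`); clause (1) is
`isClosed_cutLocus_of_injective_mfderiv`, whose hypothesis `hID` is supplied by the fact since a
vector `u` with `γ_u|[0,s]` minimizing for some `s > 1` lies in `ID(p)` by definition. The manifold
is geodesically complete by `isGeodesicallyComplete_of_isCompact_closedBall`.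
[cite: LeeRiemannianManifolds2018, Thm. 10.34 (a), (c) and Prop. 10.32 (a)] -/
theorem cutLocus_isClosed_and_mem_of_two_le_of_injectivityDomain
    (h : lee_expMap_injectivityDomain.{u, v, w}) :
    cutLocus_isClosed_and_mem_of_two_le.{u, v, w} := by
  intro E _ _ _ H _ I _ M _ _ _ _ _ g hg hc p
  haveI : CompleteSpace E := FiniteDimensional.complete ℝ E
  haveI : g.HasLeviCivita := g.hasLeviCivita
  haveI : CovariantDerivative.ContMDiffCovariantDerivative g.leviCivita 1 :=
    ⟨g.isLocallyContMDiff_leviCivita_holds 1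
      (by rw [show ((1 : ℕ∞) : ℕ∞ω) + 1 = 2 by norm_num]; exact WithTop.coe_le_coe.2 le_top)
      univ isOpen_univ⟩
  have hcompl : IsGeodesicallyComplete g.leviCivita :=
    isGeodesicallyComplete_of_isCompact_closedBall hg hc
  refine ⟨?_, fun q h2 ↦ mem_cutLocus_of_two_le_minimalGeodesicMultiplicity I g hg hc h2⟩
  refine isClosed_cutLocus_of_injective_mfderiv g le_rfl hg hcompl p fun u s hs hmin ↦ ?_
  obtain ⟨-, -, -, -, hbij⟩ := h le_rfl g hg hcompl p
  exact (hbij (show TangentSpace I p from u) ⟨s, hs, hmin⟩).1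

end Literature.Geometry.Riemannian
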